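import Summits.AtomisticToContinuum.FouriersLaw.Theorems.VanishingNoiseTransferNoiseLocalityStubFlipDissipationBound

/-!
# Stub `stub_noisyPositive` of crux `NoiseLocality`, part 1: weak `L¹(μ_T)` solutions of the
inhomogeneous adjoint equation `∫ (L F) k dμ_T = ∫ F f dμ_T` are smooth, and solve it pointwise

Helper file `--supports stmt-AtomisticToContinuum-11975` (crux `NoiseLocality`, route
`VanishingNoiseTransfer`, line `relative-flip-energy-transfer`, stub `stub_noisyPositive`).

For the pinned anharmonic chain `P = pinnedChain ω₂ lam β γ` (`ω₂ > 0`, `lam, β ≥ 0`, `γ > 0`, `N ≥ 1`,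
`T > 0`), the equilibrium generator `L = L_{T,T}`, the Gibbs measure `μ_T` and a SMOOTH right-hand
side `f`:

* `exists_contDiff_ae_eq_of_weak_inhom` — an integrable `k` with `∫ (L F) k dμ_T = ∫ F f dμ_T` for
  all `F ∈ C_c^∞` agrees a.e. (Lebesgue and `μ_T`) with a `C^∞` function: the signed density
  `k e^{-H/T}` solves `L*(k e^{-H/T}) = f e^{-H/T}` in `𝓓'` for the Hörmander-type Fokker–Planck
  operator `L*` (bracket condition `isBracketGenerating_hormanderFamily`, CEHR Prop. 4.1), and
  Hörmander's Theorem 1.1 (`hormander1967_thm11_proof`, proved in the tree) applies with the smooth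
  image `f e^{-H/T}` — the inhomogeneous variant of `exists_contDiff_ae_eq_of_weak_resolvent`;
* `adjoint_eq_of_weak` — for a `C²` solution `k` the equation holds POINTWISE in the form
  `(L (k∘Θ))(Θ x) = f x` (`Θ(q,p) = (q,-p)`), by `L† = Θ L Θ`
  (`pinnedChain_integral_generator_mul_gibbsMeasure_eq_reversal`) and the fundamental lemma of the
  calculus of variations.

No definitions.
-/

noncomputable section

open MeasureTheory Filter Topology Set Function TopologicalSpace
open scoped ContDiff ENNReal Distributions

namespace Summit.AtomisticToContinuum.FouriersLaw.Theorems.NoiseLocality.StubNoisyPositive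

open Literature.MathematicalPhysics.KineticTheory.HeatConduction
open Literature.Analysis.Distribution
open Summit.AtomisticToContinuum.FouriersLaw.Theorems.OddSectorIrreversibility

variable {N : ℕ}

/-- **Weak `L¹(μ_T)` solutions of `L† k = f` with smooth `f` are smooth.** For the pinned chain
(`ω₂ > 0`, `lam, β ≥ 0`, `γ > 0`, `N ≥ 1`, `T > 0`), the equilibrium generator `L = L_{T,T}` and a smooth
`f`: if `k` is measurable, `μ_T`-integrable and `∫ (L F) k dμ_T = ∫ F f dμ_T` for all `F ∈ C_c^∞`, then
`k` agrees Lebesgue-a.e. and `μ_T`-a.e. with a `C^∞` function (Hörmander 1967 Thm 1.1 for the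
Fokker–Planck operator `L*`, whose formal transpose is `L`, applied to the distribution `k e^{-H/T} dx`
with the smooth image `f e^{-H/T}`). [cite: Hormander1967, Thm 1.1]
[cite: CuneoEckmannHairerReyBellet2018, Prop 4.1] -/
theorem exists_contDiff_ae_eq_of_weak_inhom {ω₂ lam β γ : ℝ} (hω : 0 < ω₂) (hl : 0 ≤ lam)
    (hβ : 0 ≤ β) (hγ : 0 < γ) (hN : 0 < N) {T : ℝ} (hT : 0 < T)
    {f : PhaseSpace N → ℝ} (hf : ContDiff ℝ ∞ f)
    {k : PhaseSpace N → ℝ} (hkm : Measurable k)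
    (hk : Integrable k ((pinnedChain ω₂ lam β γ).gibbsMeasure N T))
    (hweak : ∀ F : PhaseSpace N → ℝ, ContDiff ℝ ∞ F → HasCompactSupport F →
      ∫ x, (pinnedChain ω₂ lam β γ).generator N T T F x * k x
        ∂((pinnedChain ω₂ lam β γ).gibbsMeasure N T) =
      ∫ x, F x * f x ∂((pinnedChain ω₂ lam β γ).gibbsMeasure N T)) :
    ∃ g : PhaseSpace N → ℝ, ContDiff ℝ ∞ g ∧ k =ᵐ[volume] g ∧
      k =ᵐ[(pinnedChain ω₂ lam β γ).gibbsMeasure N T] g := by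
  set P := pinnedChain ω₂ lam β γ with hP
  have hU : ContDiff ℝ ∞ P.U := pinnedChain_contDiff_U ω₂ lam β γ
  have hV : ContDiff ℝ ∞ P.V := pinnedChain_contDiff_V ω₂ lam β γ
  have hγ' : P.γ = γ := rfl
  haveI := isAddHaarMeasure_volume_phaseSpace N
  set ρ : PhaseSpace N → ℝ := P.gibbsDensity N T with hρ
  have hρs : ContDiff ℝ ∞ ρ := contDiff_gibbsDensity P hU hV N T
  have hρc : Continuous ρ := hρs.continuous
  have hρpos : ∀ x, 0 < ρ x := fun x => P.gibbsDensity_pos N T x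
  have hint : Integrable ρ := pinnedChain_integrable_gibbsDensity hω hl hβ γ N hT
  have hZpos : 0 < ∫ x, ρ x := integral_exp_pos hint
  -- `m = k ρ` is Lebesgue integrable
  set m : PhaseSpace N → ℝ := fun x => k x * ρ x with hm
  have hmm : Measurable m := hkm.mul hρc.measurable
  have hmi : Integrable m := by
    have h1 := hk
    rw [P.gibbsMeasure_eq_smul_withDensity hint, integrable_smul_measure] at h1
    · rw [integrable_withDensity_iff_integrable_smul' hρc.measurable.ennreal_ofReal
        (Eventually.of_forall fun _ => ENNReal.ofReal_lt_top)] at h1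
      refine h1.congr (Eventually.of_forall fun x => ?_)
      simp only [hm, smul_eq_mul, ENNReal.toReal_ofReal (hρpos x).le, mul_comm]
    · exact ENNReal.inv_ne_zero.2 (P.partitionFunction_ne_top hint)
    · exact ENNReal.inv_ne_top.2 (P.partitionFunction_ne_zero hρc)
  -- the weak equation in Lebesgue form: `∫ (L φ) m = ∫ (f ρ) φ`
  have hweak' : ∀ φ : PhaseSpace N → ℝ, ContDiff ℝ ∞ φ → HasCompactSupport φ →
      ∫ x, P.generator N T T φ x * m x = ∫ x, (f x * ρ x) * φ x := by
    intro φ hφ hφc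
    have h0 := hweak φ hφ hφc
    rw [P.integral_gibbsMeasure, P.integral_gibbsMeasure] at h0
    have h1 := mul_left_cancel₀ (inv_ne_zero hZpos.ne') h0
    have e1 : (fun x => P.generator N T T φ x * m x) = fun x => P.generator N T T φ x * k x * ρ x := by
      funext x; simp only [hm]; ring
    have e2 : (fun x => (f x * ρ x) * φ x) = fun x => φ x * f x * ρ x := by
      funext x; ring
    rw [e1, e2]
    exact h1
  -- the signed density as a distribution: difference of two finite measures
  set mp : Measure (PhaseSpace N) := volume.withDensity fun x => ENNReal.ofReal (m x) with hmp
  set mn : Measure (PhaseSpace N) := volume.withDensity fun x => ENNReal.ofReal (-m x) with hmn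
  haveI : IsFiniteMeasure mp := isFiniteMeasure_withDensity_ofReal hmi.hasFiniteIntegral
  haveI : IsFiniteMeasure mn := isFiniteMeasure_withDensity_ofReal hmi.neg.hasFiniteIntegral
  have hpair : ∀ φ : PhaseSpace N → ℝ, Continuous φ → HasCompactSupport φ →
      (∫ x, φ x ∂mp) - ∫ x, φ x ∂mn = ∫ x, φ x * m x := by
    intro φ hφ hφc
    obtain ⟨C, hC⟩ := hφ.bounded_above_of_compact_support hφc
    have hmm' : Measurable fun x => ENNReal.ofReal (-m x) := hmm.neg.ennreal_ofReal
    rw [hmp, hmn, integral_withDensity_eq_integral_toReal_smul hmm.ennreal_ofReal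
        (Eventually.of_forall fun _ => ENNReal.ofReal_lt_top),
      integral_withDensity_eq_integral_toReal_smul hmm'
        (Eventually.of_forall fun _ => ENNReal.ofReal_lt_top)]
    simp only [ENNReal.toReal_ofReal', smul_eq_mul]
    have i1 : Integrable (fun x => max (m x) 0 * φ x) :=
      hmi.pos_part.mul_bdd hφ.aestronglyMeasurable (Eventually.of_forall hC)
    have i2 : Integrable (fun x => max (-m x) 0 * φ x) :=
      hmi.neg_part.mul_bdd hφ.aestronglyMeasurable (Eventually.of_forall hC)
    rw [← integral_sub i1 i2]
    refine integral_congr_ae (Eventually.of_forall fun x => ?_)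
    have := max_zero_sub_max_neg_zero_eq_self (m x)
    calc max (m x) 0 * φ x - max (-m x) 0 * φ x = (max (m x) 0 - max (-m x) 0) * φ x := by ring
      _ = φ x * m x := by rw [this, mul_comm]
  set u : 𝓓'((⊤ : Opens (PhaseSpace N)), ℝ) :=
    measureDistribution mp ⊤ - measureDistribution mn ⊤ with hu
  have hu' : ∀ φ : 𝓓((⊤ : Opens (PhaseSpace N)), ℝ), u φ = ∫ x, φ x * m x := fun φ => by
    show measureDistribution mp ⊤ φ - measureDistribution mn ⊤ φ = _
    rw [measureDistribution_apply, measureDistribution_apply]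
    exact hpair φ φ.contDiff.continuous φ.hasCompactSupport
  -- Hörmander's theorem for `L*`
  have hH := Literature.Analysis.Hypoelliptic.hormander1967_thm11_proof
  have hγT : 0 < P.γ * T := by rw [hγ']; positivity
  have hV2 : ∀ r, deriv (deriv P.V) r ≠ 0 := fun r => by
    rw [hP, pinnedChain_deriv_deriv_V]; positivity
  have hbr := P.isBracketGenerating_hormanderFamily hN T T hU hV hγT hV2
  have hyp := hH (PhaseSpace N) volume (Fin 2) ⊤ (P.adjointDrift N) (P.bathField hN T T)
    (fun _ => 2 * P.γ - 0) (P.contDiff_adjointDrift hU hV N) (fun _ => contDiff_const)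
    contDiff_const (fun x _ => hbr x (Set.mem_univ x))
  have hsm : Literature.Analysis.Distribution.IsSmoothOn u volume univ := by
    refine hyp u univ isOpen_univ (subset_univ _)
      ⟨fun x => f x * ρ x, (hf.mul hρs).contDiffOn, fun φ ψ _ hψ => ?_⟩
    rw [hu' ψ]
    have hψ' : ∀ x, ψ x = P.generator N T T φ x := fun x => by
      rw [show ψ x = hormanderTranspose (P.adjointDrift N) (P.bathField hN T T)
        (fun _ => 2 * P.γ - 0) φ x from congrFun hψ x,
        hormanderTranspose_shift P hU hV hN hγT.le hγT.le 0 φ.contDiff x]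
      ring
    simp_rw [hψ']
    exact hweak' φ φ.contDiff φ.hasCompactSupport
  -- extract the smooth function and compare with `m`
  obtain ⟨g, hg, hgint⟩ := hsm
  rw [contDiffOn_univ] at hg
  have hmg : ∀ᵐ x ∂volume, m x = g x := by
    refine ae_eq_of_integral_contDiff_smul_eq hmi.locallyIntegrable
      hg.continuous.locallyIntegrable fun φ hφ hφc => ?_
    let ψ : 𝓓((⊤ : Opens (PhaseSpace N)), ℝ) := ⟨φ, hφ, hφc, fun _ _ => trivial⟩
    have h1 := hgint ψ (subset_univ _)
    rw [hu' ψ] at h1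
    simp only [smul_eq_mul]
    have e1 : ∫ x, φ x * m x = ∫ x, ψ x * m x := rfl
    rw [e1, h1]
    exact integral_congr_ae (Eventually.of_forall fun x => by show g x * ψ x = ψ x * g x; ring)
  refine ⟨fun x => g x / ρ x, hg.div hρs fun x => (hρpos x).ne', ?_, ?_⟩
  · filter_upwards [hmg] with x hx
    simp only [hm] at hx
    field_simp [(hρpos x).ne']
    linarith
  · refine (P.gibbsMeasure_absolutelyContinuous N T).ae_eq ?_
    filter_upwards [hmg] with x hx
    simp only [hm] at hx
    field_simp [(hρpos x).ne']
    linarith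

/-- **The adjoint equation holds pointwise for `C²` solutions.** For the pinned chain (`ω₂ > 0`,
`lam, β ≥ 0`, any `γ`, `T > 0`), `f` continuous and `k ∈ C²` with `∫ (L_{T,T} F) k dμ_T = ∫ F f dμ_T` for
all `F ∈ C_c^∞`: `(L_{T,T}(k∘Θ))(Θx) = f x` for EVERY `x`, `Θ(q,p) = (q,-p)` — i.e. `L† k = f` with the
`L²(μ_T)`-adjoint `L† = Θ L Θ` (`pinnedChain_integral_generator_mul_gibbsMeasure_eq_reversal`), first
`μ_T`-a.e. by the fundamental lemma of the calculus of variations, then everywhere by continuity.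
[cite: KunduDharNarayan2009, eq. (reln2)] -/
theorem adjoint_eq_of_weak {ω₂ lam β γ : ℝ} (hω : 0 < ω₂) (hl : 0 ≤ lam) (hβ : 0 ≤ β) {T : ℝ}
    (hT : 0 < T) {f : PhaseSpace N → ℝ} (hf : Continuous f) {k : PhaseSpace N → ℝ}
    (hk : ContDiff ℝ 2 k)
    (hweak : ∀ F : PhaseSpace N → ℝ, ContDiff ℝ ∞ F → HasCompactSupport F →
      ∫ x, (pinnedChain ω₂ lam β γ).generator N T T F x * k x
        ∂((pinnedChain ω₂ lam β γ).gibbsMeasure N T) =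
      ∫ x, F x * f x ∂((pinnedChain ω₂ lam β γ).gibbsMeasure N T)) (x : PhaseSpace N) :
    (pinnedChain ω₂ lam β γ).generator N T T (fun y : PhaseSpace N => k (y.1, -y.2)) (x.1, -x.2) =
      f x := by
  set P := pinnedChain ω₂ lam β γ with hP
  set π := P.gibbsMeasure N T with hπ
  haveI : IsProbabilityMeasure π := pinnedChain_isProbabilityMeasure_gibbsMeasure hω hl hβ γ N hT
  have hU1 : ContDiff ℝ 1 P.U := pinnedChain_contDiff_U ω₂ lam β γ
  have hV1 : ContDiff ℝ 1 P.V := pinnedChain_contDiff_V ω₂ lam β γ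
  set g : PhaseSpace N → ℝ := fun x =>
    P.generator N T T (fun y : PhaseSpace N => k (y.1, -y.2)) (x.1, -x.2) with hg
  have hkΘ : ContDiff ℝ 2 fun y : PhaseSpace N => k (y.1, -y.2) :=
    hk.comp (contDiff_fst.prodMk contDiff_snd.neg)
  have hgc : Continuous g :=
    (P.continuous_generator hU1 hV1 N T T hkΘ).comp (continuous_fst.prodMk continuous_snd.neg)
  -- `∫ F (g - f) dμ_T = 0` for every test `F`
  have hzero : ∀ F : PhaseSpace N → ℝ, ContDiff ℝ ∞ F → HasCompactSupport F →
      ∫ x, F x • (g x - f x) ∂π = 0 := by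
    intro F hF hFc
    have h1 := hweak F hF hFc
    have h2 := pinnedChain_integral_generator_mul_gibbsMeasure_eq_reversal ω₂ lam β γ N hT.ne'
      (hF.of_le (by norm_cast)) hFc hk
    rw [h2] at h1
    have iFg : Integrable (fun x => F x * g x) π :=
      (hF.continuous.mul hgc).integrable_of_hasCompactSupport hFc.mul_right
    have iFf : Integrable (fun x => F x * f x) π :=
      (hF.continuous.mul hf).integrable_of_hasCompactSupport hFc.mul_right
    have e : (fun x => F x • (g x - f x)) = fun x => F x * g x - F x * f x := by
      funext x; simp only [smul_eq_mul]; ring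
    rw [e, integral_sub iFg iFf, sub_eq_zero]
    exact h1
  -- hence `g = f` `μ_T`-a.e., Lebesgue-a.e., and everywhere
  have hae : ∀ᵐ x ∂π, g x - f x = 0 :=
    ae_eq_zero_of_integral_contDiff_smul_eq_zero (hgc.sub hf).locallyIntegrable hzero
  have hvol : (volume : Measure (PhaseSpace N)) ≪ π := by
    rw [hπ, P.gibbsMeasure_eq]
    refine absolutelyContinuous_tilted ?_
    have h := pinnedChain_integrable_gibbsDensity hω hl hβ γ N hT
    exact h
  have hae' : (fun x => g x - f x) =ᵐ[volume] fun _ => (0 : ℝ) := hvol.ae_eq hae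
  have heq := (Continuous.ae_eq_iff_eq volume (hgc.sub hf) continuous_const).1 hae'
  have hx : g x - f x = 0 := congrFun heq x
  exact sub_eq_zero.1 hx


/-! ### Registered helper sub-goal (stub form, one line) -/

/-- Registered helper sub-goal `helper_noisyPositiveAdjointEqOfWeak` of stub `stub_noisyPositive`
(= `adjoint_eq_of_weak` in stub form): a `C²` weak solution of `∫ (L_{T,T} F) U dμ_T = ∫ F f dμ_T` with
continuous `f` solves `(L(U∘Θ))(Θx) = f x` pointwise. -/
theorem helper_noisyPositiveAdjointEqOfWeak : ∀ ω₂ lam β γ : ℝ, 0 < ω₂ → 0 ≤ lam → 0 ≤ β → ∀ (N : ℕ) (T : ℝ), 0 < T → ∀ f U : Literature.MathematicalPhysics.KineticTheory.HeatConduction.PhaseSpace N → ℝ, Continuous f → ContDiff ℝ 2 U → (∀ F : Literature.MathematicalPhysics.KineticTheory.HeatConduction.PhaseSpace N → ℝ, ContDiff ℝ ((⊤ : ℕ∞) : WithTop ℕ∞) F → HasCompactSupport F → ∫ x, (Literature.MathematicalPhysics.KineticTheory.HeatConduction.pinnedChain ω₂ lam β γ).generator N T T F x * U x ∂((Literature.MathematicalPhysics.KineticTheory.HeatConduction.pinnedChain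 ω₂ lam β γ).gibbsMeasure N T) = ∫ x, F x * f x ∂((Literature.MathematicalPhysics.KineticTheory.HeatConduction.pinnedChain ω₂ lam β γ).gibbsMeasure N T)) → ∀ x : Literature.MathematicalPhysics.KineticTheory.HeatConduction.PhaseSpace N, (Literature.MathematicalPhysics.KineticTheory.HeatConduction.pinnedChain ω₂ lam β γ).generator N T T (fun y : Literature.MathematicalPhysics.KineticTheory.HeatConduction.PhaseSpace N => U (y.1, -y.2)) (x.1, -x.2) = f x := by
  intro ω₂ lam β γ hω hl hβ N T hT f U hf hU hweak x
  exact adjoint_eq_of_weak hω hl hβ hT hf hU hweak x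

end Summit.AtomisticToContinuum.FouriersLaw.Theorems.NoiseLocality.StubNoisyPositive

end
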